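import Mathlib.NumberTheory.ModularForms.JacobiTheta.TwoVariable

/-!
# SoloBlind — the chemical potential of the quantum rotor is an imaginary temporal gauge field

Solo-blind `AtomisticToContinuum / BoseEinsteinCondensation`, census line N12 / claim C121.

For the quantum rotor `H = (U/2) Σ_x (L_x − ν)² − J Σ cos(θ_x − θ_y)` with time step `ε`, the
one-site temporal transfer weight in the angle basis is the *twisted circle heat kernel*

  `K_{t,ν}(φ) = Σ_{n ∈ ℤ} exp(i n φ − t (n − ν)² / 2)`,   `t = εU > 0`,

(`ν = 0` is the circle heat kernel, cf. `Literature.MathematicalPhysics.QuantumLattice.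
circleHeatKernel_eq_jacobiTheta₂`). We prove, from Mathlib's Jacobi transformation formula
`jacobiTheta₂_functional_equation` alone, the Poisson-dual ("Villain") form

  `K_{t,ν}(φ) = √(2π/t) · Σ_{k ∈ ℤ} exp(−(φ + 2πk)²/(2t) + i ν (φ + 2πk))`
  (`rotorWeight_eq_villainTwisted`),

and that each dual term is the Villain weight at inverse temperature `1/t` with the purely
IMAGINARY gauge shift `ψ ↦ ψ − i t ν` of the lifted angle `ψ = φ + 2πk`, up to the constant
`exp(−tν²/2)` (`villainTwisted_term_eq_imaginary_shift`). Consequences recorded as lemmas: at integer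
filling the phases are a pure gauge `exp(iνφ)` (`twist_phase_of_int`), at half-integer filling they
are `exp(iνφ)·(−1)^k` (`twist_phase_of_half_int`), and along a closed temporal cycle whose lifted
increments sum to `2π w` the phases multiply to the Aharonov–Bohm factor `exp(2π i ν w)`
(`prod_twist_phase_eq_winding`). This is the identity behind the (filling × method) map of the
wall statement: reflection positivity needs `2ν ∈ ℤ`, the Ginibre/Wells/reconstruction cone needs
`ν ∈ ℤ`.

No axioms beyond Mathlib; sorry-free.
-/

open Complex

namespace Summit.AtomisticToContinuum.BoseEinsteinCondensation.Theorems

/-- The twisted circle heat kernel / rotor temporal transfer weight at filling `ν`: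
`K_{t,ν}(φ) = Σ_n exp(i n φ − t (n − ν)²/2)`. -/
noncomputable def rotorWeight (t ν φ : ℝ) : ℂ :=
  ∑' n : ℤ, cexp (I * n * φ - t * ((n : ℂ) - ν) ^ 2 / 2)

/-- The `k`-th Villain term with the filling phase: `exp(−(φ+2πk)²/(2t) + iν(φ+2πk))`. -/
noncomputable def villainTwistedTerm (t ν φ : ℝ) (k : ℤ) : ℂ :=
  cexp (-((φ : ℂ) + 2 * Real.pi * k) ^ 2 / (2 * t) + I * ν * ((φ : ℂ) + 2 * Real.pi * k))

/-- The Poisson-dual (Villain) form `√(2π/t) Σ_k exp(−(φ+2πk)²/(2t) + iν(φ+2πk))`. -/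
noncomputable def villainTwisted (t ν φ : ℝ) : ℂ :=
  (Real.sqrt (2 * Real.pi / t) : ℂ) * ∑' k : ℤ, villainTwistedTerm t ν φ k

/-- The rotor weight is `exp(−tν²/2)` times a Jacobi theta value at the COMPLEX point
`z = (φ − i t ν)/(2π)`, `τ = i t/(2π)`: the filling shifts `z` off the real axis. -/
theorem rotorWeight_eq_jacobiTheta₂ (t ν φ : ℝ) :
    rotorWeight t ν φ =
      cexp (-(t * ν ^ 2 / 2 : ℝ)) *
        jacobiTheta₂ (((φ : ℂ) - I * t * ν) / (2 * Real.pi)) (I * t / (2 * Real.pi)) := by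
  have hπ : (Real.pi : ℂ) ≠ 0 := ofReal_ne_zero.mpr Real.pi_ne_zero
  unfold rotorWeight jacobiTheta₂
  rw [← tsum_mul_left]
  refine tsum_congr fun n => ?_
  rw [jacobiTheta₂_term, ← Complex.exp_add]
  congr 1
  push_cast
  field_simp
  ring_nf
  try rw [I_pow_four]
  try rw [I_pow_three]
  try rw [I_sq]
  ring

/-- The exponent bookkeeping of the Jacobi transformation for the twisted kernel. -/
private lemma exponent_identity (t ν φ : ℝ) (k : ℤ) (ht : t ≠ 0) :
    -((t * ν ^ 2 / 2 : ℝ) : ℂ) +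
      (-Real.pi * I * (((φ : ℂ) - I * t * ν) / (2 * Real.pi)) ^ 2 / (I * t / (2 * Real.pi))) +
      (2 * Real.pi * I * k * ((((φ : ℂ) - I * t * ν) / (2 * Real.pi)) / (I * t / (2 * Real.pi))) +
        Real.pi * I * (k : ℂ) ^ 2 * (-1 / (I * t / (2 * Real.pi)))) =
      -((φ : ℂ) + 2 * Real.pi * (-k : ℤ)) ^ 2 / (2 * t) +
        I * ν * ((φ : ℂ) + 2 * Real.pi * (-k : ℤ)) := by
  have hπ : (Real.pi : ℂ) ≠ 0 := ofReal_ne_zero.mpr Real.pi_ne_zero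
  have htc : (t : ℂ) ≠ 0 := ofReal_ne_zero.mpr ht
  push_cast
  field_simp
  ring_nf
  try rw [I_pow_four]
  try rw [I_pow_three]
  try rw [I_sq]
  ring

/-- `(-i) · (i t / 2π) = t / 2π`. -/
private lemma negI_mul_tau (t : ℝ) :
    -I * (I * t / (2 * Real.pi)) = ((t / (2 * Real.pi) : ℝ) : ℂ) := by
  push_cast
  ring_nf
  rw [I_sq]
  ring

/-- The prefactor of the transformation formula is the real number `√(2π/t)`. -/
private lemma prefactor_eq (t : ℝ) (ht : 0 < t) :
    1 / (-I * (I * t / (2 * Real.pi))) ^ (1 / 2 : ℂ) = (Real.sqrt (2 * Real.pi / t) : ℂ) := by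
  rw [negI_mul_tau]
  have hx : 0 ≤ t / (2 * Real.pi) := by positivity
  have hhalf : (1 / 2 : ℂ) = ((1 / 2 : ℝ) : ℂ) := by push_cast; ring
  rw [hhalf, ← Complex.ofReal_cpow hx, ← Real.sqrt_eq_rpow]
  have hs : Real.sqrt (2 * Real.pi / t) = 1 / Real.sqrt (t / (2 * Real.pi)) := by
    rw [one_div, ← Real.sqrt_inv, inv_div]
  rw [hs]
  push_cast
  rfl

/-- **C121, Poisson-dual form.** For `t > 0`,
`Σ_n exp(i n φ − t(n−ν)²/2) = √(2π/t) Σ_k exp(−(φ+2πk)²/(2t) + iν(φ+2πk))`. -/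
theorem rotorWeight_eq_villainTwisted (t ν φ : ℝ) (ht : 0 < t) :
    rotorWeight t ν φ = villainTwisted t ν φ := by
  rw [rotorWeight_eq_jacobiTheta₂, jacobiTheta₂_functional_equation, prefactor_eq t ht]
  unfold villainTwisted
  -- reindex the Villain sum by `k ↦ -k`
  have hre : ∑' k : ℤ, villainTwistedTerm t ν φ k =
      ∑' k : ℤ, villainTwistedTerm t ν φ (-k) :=
    ((Equiv.neg ℤ).tsum_eq (villainTwistedTerm t ν φ)).symm
  rw [hre]
  unfold jacobiTheta₂
  rw [← tsum_mul_left, ← tsum_mul_left, ← tsum_mul_left]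
  refine tsum_congr fun k => ?_
  rw [jacobiTheta₂_term, villainTwistedTerm, ← exponent_identity t ν φ k ht.ne']
  simp only [Complex.exp_add]
  ring

/-- Each dual term is the Villain weight at inverse temperature `1/t` with the purely imaginary
gauge shift `ψ ↦ ψ − i t ν` (`ψ = φ + 2πk`), times the constant `exp(−tν²/2)`:
the chemical potential `μ = νU` is an imaginary temporal vector potential `i ε μ`. -/
theorem villainTwistedTerm_eq_imaginary_shift (t ν φ : ℝ) (k : ℤ) (ht : t ≠ 0) :
    villainTwistedTerm t ν φ k =
      cexp (-(((φ : ℂ) + 2 * Real.pi * k) - I * t * ν) ^ 2 / (2 * t)) *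
        cexp (-((t * ν ^ 2 / 2 : ℝ) : ℂ)) := by
  have htc : (t : ℂ) ≠ 0 := ofReal_ne_zero.mpr ht
  rw [villainTwistedTerm, ← Complex.exp_add]
  congr 1
  push_cast
  field_simp
  ring_nf
  rw [I_sq]
  ring

/-- At INTEGER filling the phase is `k`-independent — a pure gauge `exp(iνφ)`; the dual measure is
then positive (the Ginibre / Wells / reconstruction cone). -/
theorem twist_phase_of_int (m : ℤ) (φ : ℝ) (k : ℤ) :
    cexp (I * (m : ℂ) * ((φ : ℂ) + 2 * Real.pi * k)) = cexp (I * (m : ℂ) * φ) := by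
  have : I * (m : ℂ) * ((φ : ℂ) + 2 * Real.pi * k) =
      I * (m : ℂ) * φ + ((m * k : ℤ) : ℂ) * (2 * Real.pi * I) := by
    push_cast; ring
  rw [this, Complex.exp_add, Complex.exp_int_mul_two_pi_mul_I, mul_one]

/-- At HALF-INTEGER filling `ν = m + 1/2` the phase is `exp(iνφ)·(−1)^k`: the dual weight is real
but signed (the reflection-positivity line `2ν ∈ ℤ` off the Ginibre cone). -/
theorem twist_phase_of_half_int (m : ℤ) (φ : ℝ) (k : ℤ) :
    cexp (I * ((m : ℂ) + 1 / 2) * ((φ : ℂ) + 2 * Real.pi * k)) =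
      cexp (I * ((m : ℂ) + 1 / 2) * φ) * (-1) ^ k := by
  have : I * ((m : ℂ) + 1 / 2) * ((φ : ℂ) + 2 * Real.pi * k) =
      I * ((m : ℂ) + 1 / 2) * φ + ((m * k : ℤ) : ℂ) * (2 * Real.pi * I) + k * (Real.pi * I) := by
    push_cast; ring
  rw [this, Complex.exp_add, Complex.exp_add, Complex.exp_int_mul_two_pi_mul_I, mul_one]
  congr 1
  rw [Complex.exp_int_mul, Complex.exp_pi_mul_I]

/-- Along a closed temporal cycle whose lifted increments `ψ_τ` sum to `2π w` (`w` = winding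
number), the filling phases multiply to the Aharonov–Bohm factor `exp(2π i ν w)`. -/
theorem prod_twist_phase_eq_winding {ι : Type*} (s : Finset ι) (ψ : ι → ℝ) (ν : ℝ) (w : ℤ)
    (hw : ∑ τ ∈ s, ψ τ = 2 * Real.pi * w) :
    ∏ τ ∈ s, cexp (I * ν * ψ τ) = cexp (2 * Real.pi * I * ν * w) := by
  rw [← Complex.exp_sum, ← Finset.mul_sum]
  have : ∑ τ ∈ s, (ψ τ : ℂ) = ((2 * Real.pi * w : ℝ) : ℂ) := by
    rw [← hw]; push_cast; rfl
  rw [this]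
  congr 1
  push_cast
  ring

/-- At integer filling every Aharonov–Bohm factor is `1`. -/
theorem winding_phase_of_int (m w : ℤ) :
    cexp (2 * Real.pi * I * (m : ℂ) * w) = 1 := by
  have : 2 * Real.pi * I * (m : ℂ) * w = ((m * w : ℤ) : ℂ) * (2 * Real.pi * I) := by
    push_cast; ring
  rw [this, Complex.exp_int_mul_two_pi_mul_I]

end Summit.AtomisticToContinuum.BoseEinsteinCondensation.Theorems
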